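import Mathlib
import HarnessLib
import HarnessLib.Audit
import Summits.SmoothPoincare4.Statement
import Literature.Topology.FourManifolds.HomotopySpheres
import Literature.Topology.FourManifolds.ConnectedSum
import Literature.Topology.FourManifolds.HomotopyS4CompactProofs
import Literature.Topology.FourManifolds.HomotopyS4OrientableProofs
import HarnessLib.Audit.Status.Attr

/-!
Route: RootDecompK

# Route RootDecompK — Root decomposition K (SchoenfliesMirror, lens 3, gen 3) — every homotopy
4-sphere is invertible (#0373) ∧ inverse = mirror in the Schoenflies group (Gabai Conj 1.12,
attacked) ∧ mirror cancellation

ROOT DECOMPOSITION NODE K of cell decomp-sp4 (D-0178, LADDER-SmoothPoincare4 rung 0; lens 3 = one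
certified translation + split beneath,
generation 3; node SchoenfliesMirror v3, lineage route RootDecompC (rev 1), adopted by the
route-writer as OR-sibling RootDecompK of C —
NO edit to C, whose one active decomposition of ThickeningBall stays the index split). TARGET = the
ROOT `_root_.SmoothPoincare4` verbatim
⟸ Invertible (= stmt-SmoothPoincare4-0373 verbatim, POOLED) ∧ SchoenfliesMirror (G12, NEW, ATTACKED)
∧ MirrorCancellation
(= stmt-SmoothPoincare4-24934 verbatim, DECLARED RESIDUAL). It suffices to show X = INV ∧ G12 ∧ MC
for every homotopy 4-sphere Σ:
(INV) Σ is a connected summand of the round S⁴ (its punctured copy Σ° is a Schoenflies ball); (G12)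
if Σ is such a summand then its
oriented mirror double Σ # Σ̄ is diffeomorphic to S⁴ — Gabai's Conjecture 1.12 «inverse = mirror in
the Schoenflies group», typed in
connected-sum language with the hypothesis telescope of #18065 and the conclusion matrix of
C.ThickeningBall; (MC) Σ # Σ̄ ≅ S⁴ ⟹ Σ ≅ S⁴.
The split is EXACT and sits in a kernel-certified square over the tree's own decls: S ⟺ INV ∧ G12 ∧
MC (`summit_iff_split₃`),
ThickeningBall #24933 ⟺ INV ∧ G12 (`thickeningBall_iff`), InvertibleStandard #18065 ⟺ G12 ∧ MC
(`invertibleStandard_iff`, using the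
tree theorem `connectedSum_sphere_sphere_holds` S⁴ # S⁴ ≅ S⁴), and MC ⟸
RootDecompH.MirrorCancellationGsc ∧ MirrorCancellationNonGsc —
so G12 is the MEET of the two classical columns (Gabai 13.1 = TH, Schoenflies = #18065) and the
cell's two recognition residuals (MC, #18065)
differ exactly by the attacked piece. Realises the card doubles-reflection-rung (as C does).
SmoothPoincare4 is NOT proved by anything here:
all three pieces are open and S-implied in kernel (C1–C3), the conjunction gives S by `closes` (3/3
binders consumed); for tribunal scoring
the ATTACKED conjunct is G12, INV is POOLED with SchoenfliesSplit/OneStabInvertible (#0373), MC is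
the DECLARED RESIDUAL (text unchanged,
residual-axis movement declared 0 by the lens — honest; new exact residual economy #18065 ⟺ G12 ∧
MC). The Mazur–Gabai dictionary D1–D6
(Schoenflies balls ≅ Diff₀(S¹×S³)/S-equivalence, inverse = complementary ball, mirror = r f r) is
DICTIONARY ONLY — never an item (critic R5).
Lean: `(∀ S : Literature.Topology.FourManifolds.HomotopySphere 4, ∃ T :
Literature.Topology.FourManifolds.HomotopySphere 4, Literature.Topology.FourManifolds.IsConnectedSum
(𝓡 4) (𝓡 4) (𝓡 4) S.carrier T.carrier (Metric.sphere (0 : EuclideanSpace ℝ (Fin 5)) 1)) ∧ (open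
scoped ContDiff in ∀ S : Literature.Topology.FourManifolds.HomotopySphere 4, (∃ (M' : Type) (_ :
TopologicalSpace M') (_ : T2Space M') (_ : SecondCountableTopology M') (_ : ChartedSpace
(EuclideanSpace ℝ (Fin 4)) M') (_ : IsManifold (𝓡 4) ∞ M'),
Literature.Topology.FourManifolds.IsConnectedSum (𝓡 4) (𝓡 4) (𝓡 4) S.carrier M' (Metric.sphere (0 :
EuclideanSpace ℝ (Fin 5)) 1)) → ∃ (P : Type) (_ : TopologicalSpace P) (_ : T2Space P) (_ :
SecondCountableTopology P) (_ : ChartedSpace (EuclideanSpace ℝ (Fin 4)) P) (_ : IsManifold (𝓡 4) ∞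
P) (_ : CompactSpace P) (oP : Literature.Topology.FourManifolds.SmoothOrientation (𝓡 4) P),
Literature.Topology.FourManifolds.IsOrientedConnectedSum S.orientation (-S.orientation) oP ∧
Nonempty (P ≃ₘ⟮𝓡 4, 𝓡 4⟯ (Metric.sphere (0 : EuclideanSpace ℝ (Fin 5)) 1))) ∧ (open scoped ContDiff
in ∀ S : Literature.Topology.FourManifolds.HomotopySphere 4, (∃ (P : Type) (_ : TopologicalSpace P)
(_ : T2Space P) (_ : SecondCountableTopology P) (_ : ChartedSpace (EuclideanSpace ℝ (Fin 4)) P) (_ :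
IsManifold (𝓡 4) ∞ P) (_ : CompactSpace P) (oP : Literature.Topology.FourManifolds.SmoothOrientation
(𝓡 4) P), Literature.Topology.FourManifolds.IsOrientedConnectedSum S.orientation (-S.orientation) oP
∧ Nonempty (P ≃ₘ⟮𝓡 4, 𝓡 4⟯ (Metric.sphere (0 : EuclideanSpace ℝ (Fin 5)) 1))) → Nonempty (S.carrier
≃ₘ⟮𝓡 4, 𝓡 4⟯ (Metric.sphere (0 : EuclideanSpace ℝ (Fin 5)) 1)))`

## Assembly
Pure logic plus proved packaging: for M ≃ₕ S⁴ with an atlas, M is compact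
(compactSpace_of_homotopyEquiv_sphere_four_holds) and orientable
(isOrientable_of_homotopyEquiv_sphere_four_holds); bundle S : HomotopySphere 4 := ⟨M, o, ⟨e⟩⟩; INV
gives an inverse T, G12 applied to the
summand witness ⟨T.carrier, …, hT⟩ gives the standard oriented mirror double, MC cancels it to
S.carrier ≃ₘ S⁴. Deciding theorem
`closes (hI : Invertible) (hG : SchoenfliesMirror) (hM : MirrorCancellation) :
_root_.SmoothPoincare4` in glue.lean (split/glue.lean of the
lens, 7 lines), all three binders consumed; certified by the lens (split/SigCheck.lean rc 0) and by
the critic's closesProbe.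

Rationale: WHY THIS LINE. Kervaire–Milnor's inverse of a homotopy sphere is its mirror, Σ # Σ̄ = ∂(Σ° × I)
(KervaireMilnorAnnals1963 §2); Mazur and Gabai
(arXiv:2212.02004 Thm 0.1, Prop 1.9/1.11, Gompf Thm 1.4) organise Schoenflies balls Δ ⊂ S⁴ into an
abelian GROUP Diff₀(S¹×S³)/S with an
involution ρ(f) = r f r, in which inverse = complementary ball and mirror = ρ; Gabai's Conjecture
1.12 («Δ Schoenflies ⟹ −Δ = Δ̄,
equivalently Δ × I = B⁵», p.5) is exactly G12 and reduces to the identity ρ = −1 on generators, with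
a NORMAL FORM available precisely
on Schoenflies balls (optimized F|W-carving/surgery presentations, Thm 0.5/11.1) and the
pseudo-isotopy toolkit (Hatcher–Wagoner, Thm
0.2/0.3/6.5; Budney–Gabai barbells arXiv:1912.09029) acting on f — this is why the cut «invertible»
is the enabling hypothesis and not a
dial. Gabai–Naylor–Schwartz (arXiv:2307.06388 Thm 1.1 p.3, Lemma 3.4, Thm 5.5 p.13) decide G12 and
INV TRUE on the Gluck-twist-on-ribbon-
disc-union family (Σ_S° × I ≅ B⁵, Σ_S° Schoenflies) while Σ_S ≅ S⁴ (= MC there, Q5.4) stays open —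
the separating population for
both non-residual pieces. Imported areas: 5-dimensional handle cancellation / Andrews–Curtis with
stabilisation, pseudo-isotopy theory of
Diff₀(S¹×S³), carving–surgery presentations. What prior routes do not do: SchoenfliesSplit /
OneStabInvertible stop at INV ∧ #18065;
C cuts TH | MC and splits TH by INDEX (DoubleBoundsTwoHandlebody ∧ PresentationSpheresStandard); H
cuts by the GSC population; no route
or Theorems file isolates «inverse = mirror» — the soloist typed Gabai 13.1, 13.3, 13.4, B2, B1-ball
and only remarks 13.2(ii) in a docstring.
Workshop record (writer decomp-sp4-writer-1 g2, cell decomp-sp4, rung 0, D-0178): root node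
SchoenfliesMirror v3 of lens 3, generation 3
(NODE 2026-08-30T03:21:41Z on HOME/STATUS.md line 111); lens kernel file
decomp-sp4-lens-3/v3/SchoenfliesMirrorV3.lean sha256
4188fa230a5d61f831eb2be4197e79fd4e7a4c5b89a5ad8e1d9849b366fef685 (7 defs, 24 theorems; lean check rc
0 · 0 sorry · 0 warnings;
`#guard_msgs … #print axioms` in-file for summit_iff_split₃ / thickeningBall_iff /
invertibleStandard_iff / summit_iff_inv_b1m / square /
closes₃ = [propext, Classical.choice, Quot.sound]); NODE-v3.md sha256
ed1d4d8b1b9380ed00196fb7494a3da32bab772f49ed2fb1279312e171a09c4b;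
split/TreeLattice.lean sha256 7d3c0953… (the square over TREE decls RootDecompC rev 1 / RootDecompH
/ SchoenfliesSplit / OneStabInvertible /
RootDecompA incl. `invertible_eq_schsplitInvertible : _ = _ := rfl`), split/SigCheck.lean sha256
f0385f96… (renderer preview + closes, rc 0),
split/glue.lean sha256 1ef439cc…, split/sig_Invertible.txt 5f5ce4e8… / sig_SchoenfliesMirror.txt
9e347ded… / sig_MirrorCancellation.txt
c11c273a…, bc/ProbeV3.lean (12/12 MUST-FAIL probes fail: P1 G12→S, P2 INV→S, P3 MC→S, P4–P6 pairs,
P7 G12→TH, P8 INV→TH, P9 G12→#18065,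
P10 MC→#18065, P11 G12, P12 INV; converses C1–C3 succeed), bc/CruxProbeV3.out.txt (BC7:
SchoenfliesMirror CLEAN, Invertible CLEAN,
MirrorCancellation CLEAN, InvertibleStandard CLEAN informational). Writer: Route.md authored from
NODE-v3.md §7 ROUTE-BLOCKS (the lens shipped
no Route.md), statements = the sig files verbatim (INV without `open scoped ContDiff in` — no bare ∞
— so it dedups to #0373; G12 and MC carry
the prefix like C's items; MC normalised-equal to #24934, verified), glue = split/glue.lean
unchanged; writer re-check of the rendered route:
schema rc 0, native glue verdict OK, tribunal kernel pre-check quick+full recorded in the writer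
NOTES. Critic verdict: CLEARED decomp-sp4-crit-1
g2 2026-08-30T03:24:03Z (HOME/STATUS.md line 114 «CLEARED … NODE lens-3 g3 SchoenfliesMirror v3 (S ⟺
Invertible[#0373] ∧ SchoenfliesMirror[G12
NEW] ∧ MirrorCancellation[#24934]; files sha256 4188fa23… / ed1d4d8b… verified) — MY lean checks:
kernel file rc0 · 0 sorry · 0 warnings · axioms
std; split/TreeLattice.lean + appended block (imports TREE Theses RootDecompA/C
rev1/H/SchoenfliesSplit/OneStabInvertible — all built now) rc0,
guards pass, and BY rfl ON THE WRITER TEXTS: SigInvertible = SchoenfliesSplit.SchsplitInvertible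
(#0373), SigMirrorCancellation =
RootDecompC.MirrorCancellation (#24934), RootDecompA.InvertibleStandard =
OneStabInvertible.InvertibleStandard (#18065); OVER TREE ITEMS with
axioms std: S ⟺ #0373 ∧ G12 ∧ #24934, TH #24933 ⟺ #0373 ∧ G12, #18065 ⟺ G12 ∧ #24934, and the
3-binder glue as the renderer will see it;
LITERATURE page hits arXiv:2307.06388 Thm 1.1 p.3, Thm 5.5 p.13, Q5.4/Q5.6 p.13 ✓; GUARDS necessity
✓ · R5 one ⟺ with a 3-fold AND beneath,
dictionary not itemised ✓ · R6 splits #18065 further, not a duplicate ✓ · R7 junk: G12's telescope =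
#18065's verbatim, only makes G12 stronger,
never vacuous; closes 3/3»; CRITIC-LEDGER.md row 03:24:03Z); per-piece critic tags — INV Invertible
#0373: POOLED · WEAKER (S ⟹, TH ⟹
kernel; P3 GENUINE: GNS Thm 5.5 balls decided Schoenflies, S open there) · ATTACKABLE (Gabai §13 Thm
13.10/13.13) · INSTRUMENTABLE (GNS Q5.6
on Φ2); G12 SchoenfliesMirror: NEW · ATTACKED · WEAKER (⟸ TH, ⟸ #18065, ⟸ S all kernel; ⟹̸ probes
P1/P7/P9) with ONE HONEST CAVEAT
recorded for the tribunal: the GNS population decides G12 AND TH together, so P3 separates G12 from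
S but NOT from TH — G12 < TH is the
STRUCTURAL identity G12 = TH|Schoenflies population (Gabai Rem 13.2(ii)) with the complementary half
INV an open, registered, attackable
existence crux — accepted exactly as H's GSC cells were, not a costume · ATTACKABLE / IDEA-PRESENT
(Gabai F|W normal form Thm 0.5/11.1,
Schoenflies group with involution Prop 1.9/1.11 ⇒ G12 ⟺ ∀f f·(rfr) S-trivial; barbells; GNS 5-d
engine) · INSTRUMENTABLE (T-MIRROR-SIDES)
— NODE SCORE; MC MirrorCancellation #24934: DECLARED-RESIDUAL (3rd round, text unchanged,
residual-axis movement 0 declared; repair census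
(a)–(d) recorded dead in NODE-v3 §6, (a) by the kernel identity MC|G12-world ⟺ SS4) · leaf
IDEA-NEEDED. Novelty reading for G12 (critic): «known
named conjecture (Gabai Conj 1.12, 2022), new PLACEMENT: typed as the exact meet TH = INV ∧ G12,
Schoenflies = G12 ∧ MC» — no registered
item dominates G12 from below; TH and #18065 dominate it from above, which is the point. Census:
T-MIRROR-SIDES (NODE-v3 §4) requested of
decomp-sp4-census (GNS F|W controls; ∂(Σ_L°) for the M2′ R-links with known embeddings; Gompf-killed
AK level spheres) — not yet M-numbered
in HOME/census/COSTUME-CENSUS-v2.md (POSTED 02:55:50Z line 89, sha256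
02211b46d43d699232fc560c718b1cf4ae1c41a87299f7c87264174dde2b97f7;
v1 sha256 2113a3b3fb46bf7e878c545d4df5cf6f6d17f195411b0a604bea94d1c5e2365a); M9/M9b (kirby-cert on
GNS balls) remains the MC test.
Prover W-items once G12 is an item: land split/TreeLattice.lean §TH-side (`thickeningBall_of_subs` /
`thickeningBall_iff`) as
Theorems/RootDecompCThickeningBallSchoenflies.lean --supports stmt-SmoothPoincare4-24933, and
`invertibleStandard_iff` /
`invertibleStandard_of_subs` --supports stmt-SmoothPoincare4-18065. Why this is novel (one
sentence): Gabai's Conjecture 1.12 had no typed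
home in the tree — this route types «inverse = mirror» as the exact meet of the thickening column
(TH = INV ∧ G12) and the Schoenflies
column (#18065 = G12 ∧ MC), so one new attackable statement accounts, kernel-exactly, for the
difference between every registered
recognition residual of the mirror family.

RANKED CRUXES. #2 SchoenfliesMirror (crux) — G12 (NEW; the ATTACKED conjunct): every homotopy
4-sphere that is a connected summand of the round S⁴ (its punctured copy is a Schoenflies ball) has
standard ORIENTED mirror double Σ # Σ̄ ≅ S⁴ (⟺ Σ° × I ≅ B⁵ ⟺ the complementary ball is the mirror
ball) — Gabai's Conjecture 1.12, «inverse = mirror in the Schoenflies group»; hypothesis telescope =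
#18065's, conclusion = C.ThickeningBall's matrix. [critic decomp-sp4-crit-1 g2, CLEARED
2026-08-30T03:24:03Z (HOME/STATUS.md line 114): NEW · ATTACKED · WEAKER (⟸ TH #24933, ⟸ #18065, ⟸ S,
kernel; ⟹̸ S/TH/#18065 by probes; caveat: P3 separates G12 from S but not from TH — structural
identity G12 = TH|Schoenflies population) · ATTACKABLE / IDEA-PRESENT (Gabai programme) ·
INSTRUMENTABLE (T-MIRROR-SIDES) — node score; BC5 plan-only GNS Thm 1.1 + 5.5] [difficulty:
open-problem] (why it might fail: a Schoenflies ball Δ ⊂ S⁴ with S⁴∖Δ° ≇ Δ̄ (equivalently f ∈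
Diff₀(S¹×S³) with f∘(r f r) not S-trivial) refutes it and SPC4 at once; only the
Gabai–Naylor–Schwartz balls are checked; no engine beyond AC-m-trivial presentations.)
[arXiv:2212.02004, arXiv:2307.06388, BudneyGabai2019, Gompf1991Killing, KervaireMilnorAnnals1963]
#3 Invertible (crux) — INV (= stmt-SmoothPoincare4-0373 `SchoenfliesSplit.SchsplitInvertible`
VERBATIM — dedup by signature intended; POOLED existence piece B2 = Gabai's Poincaré-ball embedding
conjecture §13): every homotopy 4-sphere Σ has a homotopy 4-sphere T with Σ # T ≅ S⁴ (Σ° is a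
Schoenflies ball). [critic decomp-sp4-crit-1 g2, CLEARED 2026-08-30T03:24:03Z (line 114): POOLED
#0373 · WEAKER (S ⟹, TH ⟹ kernel; P3 genuine: GNS Thm 5.5 balls) · ATTACKABLE (Gabai §13 Thm
13.10/13.13) · INSTRUMENTABLE (GNS Q5.6 on Φ2)] [difficulty: open-problem] (why it might fail: a
homotopy 4-sphere whose punctured copy embeds in no homotopy 4-sphere complement to give S⁴, i.e. a
Poincaré ball that is not Schoenflies, refutes it and SPC4; open even for Gluck balls (GNS Q5.6,
Gabai Rem 13.14, Kirby 4.23).) [arXiv:2212.02004, arXiv:2307.06388, Kirby1997,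
KervaireMilnorAnnals1963]
#4 MirrorCancellation (crux) — MC (= stmt-SmoothPoincare4-24934 `RootDecompC.MirrorCancellation`
VERBATIM — dedup by signature intended; DECLARED RESIDUAL): a homotopy 4-sphere whose oriented
mirror double Σ # Σ̄ is diffeomorphic to S⁴ is diffeomorphic to S⁴ — dictionary reading «an element
f of the Schoenflies group with ρ(f) = f⁻¹ is trivial» = reflection-equivariant Schoenflies. [critic
decomp-sp4-crit-1 g2, CLEARED 2026-08-30T03:24:03Z (line 114): DECLARED-RESIDUAL (shared with C;
text unchanged; residual-axis movement 0 declared) · leaf IDEA-NEEDED · exact residual economy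
#18065 ⟺ G12 ∧ MC, MC ⟸ H.MG ∧ H.MN] [difficulty: open-problem] (why it might fail: Its analogue Σ #
Σ̄ ≅ Sⁿ ⟹ Σ ≅ Sⁿ is FALSE whenever Θₙ ≠ 0 (Milnor spheres); in dim 4 it is open already for the
Gabai–Naylor–Schwartz spheres, where it equals standardness of the Schoenflies ball Σ_S° (GNS Thm
5.5).) [arXiv:2307.06388, Gompf1991Killing, Cerf1968, FreedmanGompfMorrisonWalker2010]

TWO-LAYER PLAN. None filed now. Foreseen: G12 ⇐ (every Schoenflies class is generated by barbell /
F|W-presentation classes fᵢ) → (each generator satisfies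
fᵢ·(r fᵢ r) S-trivial) → G12, once the Schoenflies-group vocabulary (Diff₀(S¹×S³)/S) is typed; MC is
not decomposed here (its population
cells live in RootDecompH, its index reading in RootDecompC).

KILL CRITERIA. A Schoenflies ball whose complement is not its mirror ball refutes SchoenfliesMirror
(close --reason refuted:SchoenfliesMirror) and SPC4 with
it; a Poincaré ball that is not Schoenflies refutes Invertible (shared with SchoenfliesSplit) and
SPC4; an exotic Σ with Σ # Σ̄ ≅ S⁴ refutes
MirrorCancellation (shared with C) and SPC4. Proved elsewhere: ThickeningBall #24933 proved ⇒ INV ∧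
G12 follow (kernel thickeningBall_iff) and
the route reduces to C's residual MC; InvertibleStandard #18065 proved ⇒ G12 ∧ MC follow and the
route reduces to INV (= SchoenfliesSplit);
either makes this route superseded, not refuted.

NOT DECOMPOSED YET. The reduction of G12 to generators of the Schoenflies group (barbells, F|W
normal form) and any typed Diff₀(S¹×S³) vocabulary — layer-2,
later; the GNS rung (BC5) is plan-only because the tree types IsGluckTwist for 2-knots only (no
ribbon-disc-union / undisking-number
vocabulary); MC deliberately untouched (repair census (a)–(d) dead, NODE-v3 §6).

CHEAPEST FALSIFIER. T-MIRROR-SIDES (a): redraw the Gabai–Naylor–Schwartz F|W examples and check −Δ ≅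
r(Δ) by Kirby moves (controls, decided ✓ in print); then
(c) the level 3-spheres of Gompf's killed Akbulut–Kirby handle structure on S⁴ (Gompf1991Killing;
Kirby 1989 p.15) — a resistant pair is a
G12 specimen, a certified pair a G12 instance. In-kernel checks already run by the lens: probes
P1–P12 fail as required, converses C1–C3
succeed, BC7 4/4 CLEAN; nothing cheap kills the line (S-shielded pieces, GaugeSumBarrierFour: all
gauge invariants vanish).

NUMBERS. GNS family: Σ_S° × I ≅ B⁵ proved when one ribbon disc has undisking number 1; first open
case undisking number ≥ 2 (arXiv:2307.06388 p.3,
Lemma 3.5 p.9). Θ₅ = 0 and the 5-dimensional h-cobordism theorem make «Σ° × I ≅ B⁵» equivalent to «Σ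
# Σ̄ ≅ S⁴» (Rem 3.2 p.8;
Kervaire–Milnor Lemma 2.4, proved in the tree).

DEFINITION REQUESTS. None for birth (0 new vocabulary: all three items are stated over
HomotopySphere, IsConnectedSum, IsOrientedConnectedSum, SmoothOrientation).
Wanted later for the BC5 rung and the two-layer plan: ribbon-disc unions with undisking number
(Gluck twist on D₁ ∪ D̄₂) and the Schoenflies
group Diff₀(S¹×S³)/S-equivalence with its involution ρ (Gabai Prop 1.9/1.11) — topic
Literature/Topology/FourManifolds.

Novelty: Searches (2026-08-30, by the lens seat decomp-sp4-lens-3 g3 and the critic, recorded in NODE-v3.md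
§3/§5 and STATUS line 114): rg '1\\.12|SchoenfliesMirror|inverse.*mirror' over
lean/Summits/SmoothPoincare4/SmoothPoincare4/Theses and Theorems/SoloInformed* (0 items; only the
docstring remark 13.2(ii)); corpus reads [corpus:arxiv-2212.02004 pp.1–5, §13 Rem 13.2] and
[corpus:arxiv-2307.06388 pp.3, 8–9, 13] (critic re-materialised p.3 Thm 1.1, p.13 Thm 5.5,
Q5.4/Q5.6); gen-0/gen-2 searches of the lineage (C's Novelty: lit search --hybrid ×3, lit galaxy
search --star all ×3) inherited; ledger negatives --problem SmoothPoincare4 read (0).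
Nearest prior art found: arXiv:2212.02004 (Gabai 2022: Conjecture 1.12 itself, Thm 0.5/11.1 normal
form, Prop 1.9/1.11 group with involution); arXiv:2307.06388 (GNS: Thm 1.1/5.5 decide G12 and INV on
a family, Rem 3.2 dictionary); tree routes SchoenfliesSplit / OneStabInvertible (#0373 ∧ #18065),
RootDecompC (TH ∧ MC, TH split by index), RootDecompH (GSC cells); card doubles-reflection-rung.
Delta: the named conjecture gets a typed home as the exact MEET of the two registered columns — TH =
INV ∧ G12 and #18065 = G12 ∧ MC, kernel-certified over the tree's decls — which no route, card or
paper states; the attack surface (Schoenflies group with involution, F|W normal form) exists only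
under the INV hypothesis, which is why the cut is not a costume.
Claimed grade: new-combination  [refs: 2212.02004, 2307.06388, arxiv-2212.02004, arxiv-2307.06388]

Barriers (technique_class: schoenflies-group, pseudo-isotopy, five-dim-thickening): - technique_class: schoenflies-group, pseudo-isotopy, five-dim-thickening
- Literature.Barriers.SmoothPoincare4.HCobordismBarrierFour: G12 is INSIDE the 5-dimensional
h-cobordism / handle-cancellation family by method but OUTSIDE the barrier's quantifier — it
concludes Σ # Σ̄ ≅ S⁴ / Δ × I ≅ B⁵ one dimension up (Whitney discs available), never Δ ≅ B⁴ (that is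
MC); evasion = GNS geometric 2/3-duality + Gabai F|W normal form; INV is outside (existence of an
embedding).
- Literature.Barriers.SmoothPoincare4.GaugeSumBarrierFour: outside — no gauge input anywhere; the
barrier only says SW/Donaldson-type invariants cannot REFUTE G12/INV/MC on homotopy spheres (all
vanish), consistent with «S-shielded, no cheap kill».
- Literature.Barriers.SmoothPoincare4.ContractibleBarrierFour: outside by hypothesis ∂Δ = S³ — no
piece asserts uniqueness of contractible 4-manifolds with a given boundary; corks / absolutely
exotic contractibles have homology-sphere boundaries ≠ S³; the bet: no exotic pair of Poincaré balls
exists (⟸ S).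
- Literature.Barriers.SmoothPoincare4.RelativeContractibleBarrierFour: outside — G12 and MC compare
closed manifolds / absolute balls after Gompf's uniqueness of the Schoenflies-ball correspondence;
no rel-∂ exotica are claimed impossible.
- Literature.Barriers.SmoothPoincare4.OneStabilisationBarrier: outside — G12 is an UNSTABILISED
statement about spheres (no S²×S² or ℂℙ² sum); Gabai's stable-isotopy Thm 0.2 is a tool upstairs
only; the barrier's witnesses carry big

sub-problem: SmoothPoincare4 · status: open · opened planner-decomp-sp4-writer-1-g2-0 2026-08-30T03:37:17Z · rev 0 · ledger route-SmoothPoincare4-RootDecompK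
GENERATED by the gate from the ledger (D-0016/17). Provers cite these decls: `theorem foo : Summit.SmoothPoincare4.SmoothPoincare4.Theses.RootDecompK.<Decl> := …` in Summits/SmoothPoincare4/SmoothPoincare4/Theorems/<Name>.lean.
-/

namespace Summit.SmoothPoincare4.SmoothPoincare4.Theses.RootDecompK

open scoped BigOperators Topology Manifold Classical MeasureTheory ProbabilityTheory Matrix InnerProductSpace ComplexConjugate ContinuousMap
open Filter Set Function TopologicalSpace MeasureTheory

attribute [summit_statement] _root_.SmoothPoincare4

open Literature.SPC4

/-- item stmt-SmoothPoincare4-26811 · crux · rank 2 · open · by planner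
why it might fail: a Schoenflies ball Δ ⊂ S⁴ with S⁴∖Δ° ≇ Δ̄ (equivalently f ∈ Diff₀(S¹×S³) with f∘(r f r) not S-trivial) refutes it and SPC4 at once; only the Gabai–Naylor–Schwartz balls are checked; no engine beyond AC-m-trivial presentations.
sources: arXiv:2212.02004, arXiv:2307.06388, BudneyGabai2019, Gompf1991Killing, KervaireMilnorAnnals1963
[crux] G12 (NEW; the ATTACKED conjunct): every homotopy 4-sphere that is a connected summand of the
round S⁴ (its punctured copy is a Schoenflies ball) has standard ORIENTED mirror double Σ # Σ̄ ≅ S⁴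
(⟺ Σ° × I ≅ B⁵ ⟺ the complementary ball is the mirror ball) — Gabai's Conjecture 1.12, «inverse =
mirror in the Schoenflies group»; hypothesis telescope = #18065's, conclusion = C.ThickeningBall's
matrix. [critic decomp-sp4-crit-1 g2, CLEARED 2026-08-30T03:24:03Z (HOME/STATUS.md line 114): NEW ·
ATTACKED · WEAKER (⟸ TH #24933, ⟸ #18065, ⟸ S, kernel; ⟹̸ S/TH/#18065 by probes; caveat: P3
separates G12 from S but not from TH — structural identity G12 = TH|Schoenflies population) ·
ATTACKABLE / IDEA-PRESENT (Gabai programme) · INSTRUMENTABLE (T-MIRROR-SIDES) — node score; BC5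
plan-only GNS Thm 1.1 + 5.5] [difficulty: open-problem] -/
@[route_item "route-SmoothPoincare4-RootDecompK", crux]
def SchoenfliesMirror : Prop :=
  open scoped ContDiff in ∀ S : Literature.Topology.FourManifolds.HomotopySphere 4, (∃ (M' : Type) (_ : TopologicalSpace M') (_ : T2Space M') (_ : SecondCountableTopology M') (_ : ChartedSpace (EuclideanSpace ℝ (Fin 4)) M') (_ : IsManifold (𝓡 4) ∞ M'), Literature.Topology.FourManifolds.IsConnectedSum (𝓡 4) (𝓡 4) (𝓡 4) S.carrier M' (Metric.sphere (0 : EuclideanSpace ℝ (Fin 5)) 1)) → ∃ (P : Type) (_ : TopologicalSpace P) (_ : T2Space P) (_ : SecondCountableTopology P) (_ : ChartedSpace (EuclideanSpace ℝ (Fin 4)) P) (_ : IsManifold (𝓡 4) ∞ P) (_ : CompactSpace P) (oP : Literature.Topology.FourManifolds.SmoothOrientation (𝓡 4) P), Literature.Topology.FourManifolds.IsOrientedConnectedSum S.orientation (-S.orientation) oP ∧ Nonempty (P ≃ₘ⟮𝓡 4, 𝓡 4⟯ (Metric.sphere (0 : EuclideanSpace ℝ (Fin 5)) 1))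

/-- item stmt-SmoothPoincare4-0373 · crux · rank 3 · open · by planner
why it might fail: a homotopy 4-sphere whose punctured copy embeds in no homotopy 4-sphere complement to give S⁴, i.e. a Poincaré ball that is not Schoenflies, refutes it and SPC4; open even for Gluck balls (GNS Q5.6, Gabai Rem 13.14, Kirby 4.23).
sources: arXiv:2212.02004, arXiv:2307.06388, Kirby1997, KervaireMilnorAnnals1963
∀ Σ ∃ T homotopy 4-sphere with S⁴ a connected sum Σ # T (relational
`Literature.Topology.FourManifolds.IsConnectedSum`). Implies crux #2 (Σ minus a ball sits in Σ # T =
S⁴). This is exactly the missing n = 4 case of the group structure on homotopy spheres under #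
(KervaireMilnor1963 Thm 1.1 excludes nothing but our Literature
`exists_commGroup_homotopySphereClass` assumes n ≠ 4). Sources: KervaireMilnor1963 §2; Literature
HomotopySpheres.lean. -/
@[route_item "route-SmoothPoincare4-RootDecompK", crux]
def Invertible : Prop :=
  ∀ S : Literature.Topology.FourManifolds.HomotopySphere 4, ∃ T : Literature.Topology.FourManifolds.HomotopySphere 4, Literature.Topology.FourManifolds.IsConnectedSum (𝓡 4) (𝓡 4) (𝓡 4) S.carrier T.carrier (Metric.sphere (0 : EuclideanSpace ℝ (Fin 5)) 1)

/-- item stmt-SmoothPoincare4-24934 · crux · rank 4 · open · by planner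
why it might fail: Its analogue Σ # Σ̄ ≅ Sⁿ ⟹ Σ ≅ Sⁿ is FALSE whenever Θₙ ≠ 0 (Milnor spheres); in dim 4 it is open already for the Gabai–Naylor–Schwartz spheres, where it equals standardness of the Schoenflies ball Σ_S° (GNS Thm 5.5).
sources: arXiv:2307.06388, Gompf1991Killing, Cerf1968, FreedmanGompfMorrisonWalker2010
[crux] A homotopy 4-sphere whose mirror double Σ # Σ̄ is diffeomorphic to S⁴ is itself diffeomorphic
to S⁴ (I-cancellation Σ° × I ≅ B⁵ ⟹ Σ° ≅ B⁴; Schoenflies for the reflection neck of Σ # Σ̄ = S⁴ plus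
Cerf Γ₄ = 0). DECLARED RESIDUAL of this node for tribunal scoring (no seat asked; dominated by the
imported residual stmt-SmoothPoincare4-18065 via the lens kernel lemma
mirrorCancellation_of_invertibleStandard). Critic verdict: WEAKER (dominated by (body of #18065) →
MC, #18065 ≡ #0372 mod Cerf registered WEAKER; non-vacuous: GNS Schoenflies-ball spheres have TH
certified and standardness open, GNS Thm 5.5) · IDEA-NEEDED (reflection-equivariant Schoenflies) ·
informative census run M9/M9b on the GNS balls — CLEARED decomp-sp4-crit-1-g0 2026-08-30T01:36:20Z.
[difficulty: open-problem] -/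
@[route_item "route-SmoothPoincare4-RootDecompK", crux]
def MirrorCancellation : Prop :=
  open scoped ContDiff in ∀ S : Literature.Topology.FourManifolds.HomotopySphere 4, (∃ (P : Type) (_ : TopologicalSpace P) (_ : T2Space P) (_ : SecondCountableTopology P) (_ : ChartedSpace (EuclideanSpace ℝ (Fin 4)) P) (_ : IsManifold (𝓡 4) ∞ P) (_ : CompactSpace P) (oP : Literature.Topology.FourManifolds.SmoothOrientation (𝓡 4) P), Literature.Topology.FourManifolds.IsOrientedConnectedSum S.orientation (-S.orientation) oP ∧ Nonempty (P ≃ₘ⟮𝓡 4, 𝓡 4⟯ (Metric.sphere (0 : EuclideanSpace ℝ (Fin 5)) 1))) → Nonempty (S.carrier ≃ₘ⟮𝓡 4, 𝓡 4⟯ (Metric.sphere (0 : EuclideanSpace ℝ (Fin 5)) 1))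

/-- item stmt-SmoothPoincare4-26812 · assembly · rank 1 · open · by planner
sources: arXiv:2212.02004, arXiv:2307.06388
[assembly] Invertible → SchoenfliesMirror → MirrorCancellation → SmoothPoincare4 (the type of the
proved deciding theorem closes; kept for the schema, exempt from staffing). -/
@[route_item "route-SmoothPoincare4-RootDecompK"]
def Assembly : Prop :=
  Invertible → SchoenfliesMirror → MirrorCancellation → _root_.SmoothPoincare4

/-! D-0027 §2.1 — DECIDING THEOREM (planner-authored via `route open/edit --closes-file`; by planner-decomp-sp4-writer-1-g2-0 2026-08-30T03:37:17Z):
its hypotheses are this route's items and its conclusion the sub-problem Statement (glue_lint), and it elaborates with this file. -/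

@[closes "route-SmoothPoincare4-RootDecompK"] theorem closes (hI : Invertible) (hG : SchoenfliesMirror) (hM : MirrorCancellation) :
    _root_.SmoothPoincare4 := by
  intro M _ _ _ _ _ e
  haveI : CompactSpace M :=
    Literature.Topology.FourManifolds.compactSpace_of_homotopyEquiv_sphere_four_holds M e
  obtain ⟨o⟩ := Literature.Topology.FourManifolds.isOrientable_of_homotopyEquiv_sphere_four_holds M e
  obtain ⟨T, hT⟩ := hI ⟨M, o, ⟨e⟩⟩
  exact hM ⟨M, o, ⟨e⟩⟩
    (hG ⟨M, o, ⟨e⟩⟩ ⟨T.carrier, inferInstance, inferInstance, inferInstance, T.chartedSpace, T.isManifold, hT⟩)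

end Summit.SmoothPoincare4.SmoothPoincare4.Theses.RootDecompK
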